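import Summits.HodgeConjecture.HodgeConjecture.Theorems.R90S10ClassTraceOfCharacterLine     -- ★ `R90.S10.classTrace_mk_ofChar` (C-iii-1); brings ★ `DiscreteClass`, `classTrace`, `DiscreteAutomorphicRep.ofChar`
import Literature.NumberTheory.Automorphic.UnitaryGroupPureTensorEulerProduct               -- ★ `exists_integral_eval_eq_mul_integral_arch_mul_prod` (Euler factorisation of a pure tensor); ★ `PureTensor`
import Literature.NumberTheory.Automorphic.LocalUnitaryGroupCongrMeasure                   -- ★ instances `locallyCompactSpace_cmDatum_local` (local Haar measures exist)
import HarnessLib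

/-!
# R90-TF · S10 (Rogawski 1990 §13.8) · THEOREMS — `R90S10ThetaLineClassTraceEuler`: THE CLASS TRACE OF A CHARACTER LINE AGAINST A PURE TENSOR
# IS AN EULER PRODUCT, `Tr R(⊗ f_v)|_{ℂ[Θ̄]} = κ · ∫ f_∞ Θ_∞⁻¹ · ∏_{v ∈ S} (m_v(U(H)(𝒪_v)))⁻¹ ∫ f_v Θ_v⁻¹ dm_v`

Cell hodgecm-mathlib, slab R90-TF, section S10 = §13.8, crux item h413 = stmt-HodgeConjecture-24833 (route `route-HodgeConjecture-HCCMUnconditional`).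
Prover seat LH7-p07 (g3), DEAL #58 (S10 dealer R90-C138-plan (g3), 2026-09-05T02:43Z; chair VALVE 23 (aa)): block C's Haar ∕ product brick (C-iii-2)
of R90-C138-p05 (g0)'s census `R90/R90-C138-p05/g0/CENSUS-40b-thetaLineGlobal.md` d666bc68 — «for the automorphic character line `ofChar Θ μ` of `U(H)`
and a PURE-TENSOR test function, the class trace factorises as (arch factor) × ∏_{v ∈ S} (local factors), constants absorbed in ONE `κ > 0`».  READER:
p05's block-C file for the θ-line of `ξ` (`hθi` of ★ `S10HDatum`), which instantiates `N := 1`, `H := Φ₁`, `S := {v}` and combines with his lemma (F)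
«unramified factorisation of `Θ`» (the hypothesis `hΘ` below, discharged there).

PRINT → PROOF ([BorelJacquet1979, §4.1]; [Rogawski1990, §13.8 p. 219 L1–2 «`Tr θ(f₁) = ∫ f₁ θ`», §14.2 p. 233 «`f = ⊗ f_v`»]; [Gelbart1975, §2.A]).
(1) ★ `classTrace_mk_ofChar`: `Tr R(F)|_{ℂ[Θ̄]} = ∫ F(g) Θ(g)⁻¹ dν(g)` (C-iii-1).  (2) If `F = T.eval` is a pure tensor with integral levels off its bad set `S`
and `Θ⁻¹` FACTORISES on the support box `{g | g_v ∈ U(H)(𝒪_v), v ∉ S}` as `Θ(g)⁻¹ = Θ_∞(g_∞)⁻¹ · ∏_{v∈S} Θ_v(g_v)⁻¹`, then `F · Θ⁻¹` IS AGAIN A PURE TENSOR — the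
TWISTED tensor `(f_∞ Θ_∞⁻¹) ⊗ ⊗_{v∈S} (f_v Θ_v⁻¹) ⊗ ⊗_{v∉S} 1_{U(H)(𝒪_v)}` (same bad set, same levels) — so ★ `exists_integral_eval_eq_mul_integral_arch_mul_prod`
(the `∞ ⊔ f` split + Tate's restricted-product Euler factorisation, ONE `κ > 0` for every pure tensor) gives the product.  (3) Arbitrary local Haar measures
`m_v` are admitted by normalising `m_v ↦ m_v(U(H)(𝒪_v))⁻¹ • m_v` (Haar stays Haar; `∫ f d(c • m) = c · ∫ f dm`), which produces the factors `(m_v(U(H)(𝒪_v)))⁻¹`.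

CONTENTS (all theorems; no `def`, no `instance`, no `notation`, no `sorry`; axioms ⊆ {propext, Classical.choice, Quot.sound}; generic `N`, `H`).
* §1 `exists_integral_eval_mul_eq_mul_integral_arch_mul_prod` — TWISTED EULER FACTORISATION: ONE `κ > 0` with
  `∫ T.eval · χ dν = κ · (∫ f_∞ χ_∞ dμ_∞) · ∏_{v∈S} ∫ f_v χ_v dm_v` for every pure tensor `T` (integral levels off `S`) and every `χ` factorising on `T`'s box
  as `χ(g) = χ_∞(g_∞) · ∏_{v∈S} χ_v(g_v)` (normalised `m_v(U(H)(𝒪_v)) = 1`).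
* §1 `exists_integral_eval_mul_eq_mul_integral_arch_mul_prod_of_isHaarMeasure` — the same for ARBITRARY local Haar measures, factors `(m_v(U(H)(𝒪_v)))⁻¹`.
* §2 `exists_classTrace_mk_ofChar_eq_mul_integral_arch_mul_prod` — `Tr R(F)|_{ofChar Θ μ}` for `F = T.eval` (as a `C_c` function) and `Θ` factorising on the box:
  `= κ · (∫ f_∞ Θ_∞⁻¹ dμ_∞) · ∏_{v∈S} (m_v(U(H)(𝒪_v)))⁻¹ ∫ f_v Θ_v⁻¹ dm_v`.
* §2 `exists_classTrace_mk_ofChar_inv_eq_mul_integral_arch_mul_prod` — the twin for the line `ofChar Θ⁻¹ μ` (on which `R(g) = Θ(g)`): no inverses on the right.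
* §3 `exists_isHaarMeasure_classTrace_mk_ofChar_inv_eq_integral_mul_integral` — ONE BAD PLACE `v`, consumer shape: measurable structure and Haar `mv` only at `v`,
  `F = 1_{∀ w ≠ v, g_w ∈ K w} · gi(g_∞) · gv(g_v)`, `Θ = Θ_∞ · θ_v` on that box ⊢ `∃ ν` Haar with `Tr R(F)|_{ofChar Θ⁻¹ μ} = (∫ gi Θ_∞ dμ_∞) · ∫ gv θ_v dmv` EXACTLY.
BINDERS (honest): the factorisation `hχ`∕`hΘ` of the character ON THE BOX is a HYPOTHESIS (it holds iff `Θ_v` is trivial on `U(H)(𝒪_v)` for `v ∉ S` — p05's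
lemma (F) ∕ census §3 (C-iv)); `μ` is any automorphic measure, `ν`, `μ_∞`, `m_v` any Haar measures; `κ` depends on `ν, μ_∞, (m_v)_v` only (not on `T`, `S`, `Θ`, `μ`).
SPELLING: the adelic carrier is written `(adelicGroupData L⁺ L c N H).Adelic` (the S10 consumers' `(H1 L).Adelic`, `(G3 L).Adelic`; ★ `adelicGroupData_eq_cmDatum` and
★ `adelic_complexConj` are `rfl`, so ★'s `UnitaryGroup.adelic` statements apply by unification), the local carriers `(cmDatum L N H).Local v` (★ `PureTensor`'s).
NON-VACUITY: `T.S = ∅`, `χ = 1`, `χ_∞ = 1` satisfies `hχ`; Haar measures exist on all carriers (locally compact groups, ★ `UnitaryGroupAdelicProductHaar`).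

HONEST LABEL: measure-theoretic bookkeeping over ★ inputs; pays no socket by itself (the θ-line's `hθi` still needs (F) and the (C-iv) ruling); HC_CM is proved
only modulo the 7 printed citations (2 remaining named inputs: hLiu418 = stmt-HodgeConjecture-24832, h413 = stmt-HodgeConjecture-24833) until rung 0 closes;
count-neutral helper; REL ≠ ★ ≠ BUILT.  Namespace `Summit.HodgeConjecture.HodgeConjecture.R90.S10`.

## References
* [BorelJacquet1979] A. Borel, H. Jacquet, *Automorphic forms and automorphic representations*, PSPM 33.1 (1979), §4.1.
* [Rogawski1990] J. D. Rogawski, *Automorphic Representations of Unitary Groups in Three Variables*, Ann. of Math. Stud. 123 (1990), §13.8 p. 219 L1–2; §14.2 p. 233.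
* [Gelbart1975] S. Gelbart, *Automorphic forms on adele groups*, Ann. of Math. Stud. 83 (1975), §2.A.
* [CasselsFrohlichANT1967] J. W. S. Cassels, A. Fröhlich (eds.), *Algebraic Number Theory* (1967), Ch. XV (Tate), §3.3.
-/

set_option autoImplicit false
-- the mandated namespace repeats the single-problem summit's segment (`HodgeConjecture.HodgeConjecture`)
set_option linter.dupNamespace false

noncomputable section

open MeasureTheory NumberField IsDedekindDomain CompactlySupported
open scoped NNReal ENNReal
open Literature.NumberTheory.Automorphic Literature.NumberTheory.Automorphic.UnitaryGroup
open Summit.HodgeConjecture.HodgeConjecture.Cruxes.H413.K2E1SpectralTermsDiscreteHalf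

namespace Summit.HodgeConjecture.HodgeConjecture.R90.S10

variable {L : Type} [Field L] [NumberField L] [IsCMField L] {N : ℕ} {H : Matrix (Fin N) (Fin N) L}

/-! ## §1 The twisted Euler factorisation of a pure tensor -/

/-- **TWISTED EULER FACTORISATION OF A PURE TENSOR** (normalised local measures).  For Haar measures `ν` on `U(H)(𝔸_{L⁺})`, `μ_∞` on `U(H)(L⁺ ⊗ ℝ)` and local
Haar measures `m_v` with `m_v(U(H)(𝒪_v)) = 1` there is ONE `κ > 0` such that: for every pure tensor `T = f_∞ ⊗ ⊗_v f_v` with integral levels off its bad set `S`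
and every function `χ` on `U(H)(𝔸_{L⁺})` which FACTORISES ON THE BOX `{g | g_v ∈ K_v, v ∉ S}` as `χ(g) = χ_∞(g_∞) · ∏_{v∈S} χ_v(g_v)`,
`∫ T.eval · χ dν = κ · (∫ f_∞ χ_∞ dμ_∞) · ∏_{v∈S} ∫ f_v χ_v dm_v` — because `T.eval · χ` is the pure tensor `(f_∞χ_∞) ⊗ ⊗_{v∈S}(f_vχ_v) ⊗ ⊗_{v∉S} 1_{K_v}`
(★ `exists_integral_eval_eq_mul_integral_arch_mul_prod`).  No integrability hypotheses (Bochner conventions). [cite: BorelJacquet1979, §4.1]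
[cite: Rogawski1990, §14.2 p. 233] -/
theorem exists_integral_eval_mul_eq_mul_integral_arch_mul_prod
    [iA : MeasurableSpace (adelicGroupData (↥(maximalRealSubfield L)) L (IsCMField.complexConj L) N H).Adelic]
    [iAB : BorelSpace (adelicGroupData (↥(maximalRealSubfield L)) L (IsCMField.complexConj L) N H).Adelic]
    [MeasurableSpace (UnitaryGroup.arch (↥(maximalRealSubfield L)) L (IsCMField.complexConj L) N H)]
    [BorelSpace (UnitaryGroup.arch (↥(maximalRealSubfield L)) L (IsCMField.complexConj L) N H)]
    [∀ v, MeasurableSpace ((cmDatum L N H).Local v)] [∀ v, BorelSpace ((cmDatum L N H).Local v)]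
    (ν : Measure (adelicGroupData (↥(maximalRealSubfield L)) L (IsCMField.complexConj L) N H).Adelic) [iν : ν.IsHaarMeasure]
    (μa : Measure (UnitaryGroup.arch (↥(maximalRealSubfield L)) L (IsCMField.complexConj L) N H)) [μa.IsHaarMeasure]
    (m : ∀ v, Measure ((cmDatum L N H).Local v)) [∀ v, (m v).IsHaarMeasure]
    (hm : ∀ v, m v (cmLocalIntegralLevel L N H v) = 1) :
    ∃ κ : ℝ, 0 < κ ∧ ∀ (T : PureTensor L N H), (∀ v ∉ T.S, T.K v = cmLocalIntegralLevel L N H v) →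
      ∀ (χ : (cmDatum L N H).Adelic → ℂ) (χa : UnitaryGroup.arch (↥(maximalRealSubfield L)) L (IsCMField.complexConj L) N H → ℂ)
        (χl : ∀ v, (cmDatum L N H).Local v → ℂ),
        (∀ g, (∀ v ∉ T.S, (cmDatum L N H).toLocal v g ∈ T.K v) →
          χ g = χa (archPart (↥(maximalRealSubfield L)) L (IsCMField.complexConj L) N H g) * ∏ v ∈ T.S, χl v ((cmDatum L N H).toLocal v g)) →
        ∫ g, T.eval g * χ g ∂ν = (κ : ℂ) * ((∫ a, T.arch a * χa a ∂μa) * ∏ v ∈ T.S, ∫ x, T.loc v x * χl v x ∂(m v)) := by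
  classical
  -- ★ at the `UnitaryGroup.adelic` spelling of the carrier (`adelicGroupData_eq_cmDatum`, `adelic_complexConj` are `rfl`): instances passed by unification
  obtain ⟨κ, hκ, h⟩ := @exists_integral_eval_eq_mul_integral_arch_mul_prod L _ _ _ N H iA iAB _ _ _ _ ν iν μa _ m _ hm
  refine ⟨κ, hκ, fun T hK χ χa χl hχ => ?_⟩
  -- the twisted pure tensor `T' = (f_∞ χ_∞) ⊗ ⊗_{v ∈ S} (f_v χ_v) ⊗ ⊗_{v ∉ S} 1_{K_v}`
  let T' : PureTensor L N H :=
    { S := T.S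
      K := T.K
      loc := fun v => if v ∈ T.S then (fun x => T.loc v x * χl v x) else T.loc v
      arch := fun a => T.arch a * χa a
      loc_eq_indicator := fun v hv => by
        simp only [if_neg hv]
        exact T.loc_eq_indicator v hv }
  have hS' : T'.S = T.S := rfl
  have harch' : ∀ a, T'.arch a = T.arch a * χa a := fun a => rfl
  have hloc' : ∀ v ∈ T.S, ∀ x, T'.loc v x = T.loc v x * χl v x := fun v hv x => by
    show (if v ∈ T.S then (fun x => T.loc v x * χl v x) else T.loc v) x = _
    rw [if_pos hv]
  have hK' : ∀ v ∉ T'.S, T'.K v = cmLocalIntegralLevel L N H v := hK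
  -- `T.eval · χ = T'.eval`
  have heval : ∀ g, T.eval g * χ g = T'.eval g := by
    intro g
    by_cases hg : ∀ v ∉ T.S, (cmDatum L N H).toLocal v g ∈ T.K v
    · rw [T.eval_eq_of_forall_mem g hg, hχ g hg, T'.eval_eq_of_forall_mem g hg, hS', harch',
        Finset.prod_congr rfl fun v hv => hloc' v hv ((cmDatum L N H).toLocal v g), Finset.prod_mul_distrib]
      ring
    · obtain ⟨v, hv, hgv⟩ : ∃ v, v ∉ T.S ∧ (cmDatum L N H).toLocal v g ∉ T.K v := by
        by_contra hcon
        exact hg fun v hv => by_contra fun hgv => hcon ⟨v, hv, hgv⟩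
      rw [T.eval_eq_zero_of_not_mem g hv hgv, T'.eval_eq_zero_of_not_mem g hv hgv, zero_mul]
  calc ∫ g, T.eval g * χ g ∂ν = ∫ g, T'.eval g ∂ν := integral_congr_ae (Filter.Eventually.of_forall heval)
    _ = (κ : ℂ) * ((∫ a, T'.arch a ∂μa) * ∏ v ∈ T'.S, ∫ x, T'.loc v x ∂(m v)) := h T' hK'
    _ = (κ : ℂ) * ((∫ a, T.arch a * χa a ∂μa) * ∏ v ∈ T.S, ∫ x, T.loc v x * χl v x ∂(m v)) := by
        rw [hS', Finset.prod_congr rfl fun v hv => integral_congr_ae (Filter.Eventually.of_forall (hloc' v hv))]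

/-- **TWISTED EULER FACTORISATION OF A PURE TENSOR, ARBITRARY LOCAL HAAR MEASURES.**  As `exists_integral_eval_mul_eq_mul_integral_arch_mul_prod`, for ANY local Haar
measures `m_v` on the `U(H)(L⁺_v)`: ONE `κ > 0` with `∫ T.eval · χ dν = κ · (∫ f_∞ χ_∞ dμ_∞) · ∏_{v∈S} (m_v(U(H)(𝒪_v)))⁻¹ · ∫ f_v χ_v dm_v` for every pure tensor `T`
(integral levels off `S`) and every `χ` factorising on its box — by normalising `m_v ↦ m_v(U(H)(𝒪_v))⁻¹ • m_v` (`U(H)(𝒪_v)` is compact open, ★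
`isCompact_isOpen_cmLocalIntegralLevel`, so `0 < m_v(U(H)(𝒪_v)) < ∞`; Haar stays Haar, `IsHaarMeasure.smul`; `integral_smul_measure`). [cite: BorelJacquet1979, §4.1]
[cite: Rogawski1990, §14.2 p. 233] -/
theorem exists_integral_eval_mul_eq_mul_integral_arch_mul_prod_of_isHaarMeasure
    [MeasurableSpace (adelicGroupData (↥(maximalRealSubfield L)) L (IsCMField.complexConj L) N H).Adelic]
    [BorelSpace (adelicGroupData (↥(maximalRealSubfield L)) L (IsCMField.complexConj L) N H).Adelic]
    [MeasurableSpace (UnitaryGroup.arch (↥(maximalRealSubfield L)) L (IsCMField.complexConj L) N H)]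
    [BorelSpace (UnitaryGroup.arch (↥(maximalRealSubfield L)) L (IsCMField.complexConj L) N H)]
    [∀ v, MeasurableSpace ((cmDatum L N H).Local v)] [∀ v, BorelSpace ((cmDatum L N H).Local v)]
    (ν : Measure (adelicGroupData (↥(maximalRealSubfield L)) L (IsCMField.complexConj L) N H).Adelic) [ν.IsHaarMeasure]
    (μa : Measure (UnitaryGroup.arch (↥(maximalRealSubfield L)) L (IsCMField.complexConj L) N H)) [μa.IsHaarMeasure]
    (m : ∀ v, Measure ((cmDatum L N H).Local v)) [∀ v, (m v).IsHaarMeasure] :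
    ∃ κ : ℝ, 0 < κ ∧ ∀ (T : PureTensor L N H), (∀ v ∉ T.S, T.K v = cmLocalIntegralLevel L N H v) →
      ∀ (χ : (cmDatum L N H).Adelic → ℂ) (χa : UnitaryGroup.arch (↥(maximalRealSubfield L)) L (IsCMField.complexConj L) N H → ℂ)
        (χl : ∀ v, (cmDatum L N H).Local v → ℂ),
        (∀ g, (∀ v ∉ T.S, (cmDatum L N H).toLocal v g ∈ T.K v) →
          χ g = χa (archPart (↥(maximalRealSubfield L)) L (IsCMField.complexConj L) N H g) * ∏ v ∈ T.S, χl v ((cmDatum L N H).toLocal v g)) →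
        ∫ g, T.eval g * χ g ∂ν = (κ : ℂ) * ((∫ a, T.arch a * χa a ∂μa) *
          ∏ v ∈ T.S, (((m v (cmLocalIntegralLevel L N H v)).toReal⁻¹ : ℝ) : ℂ) * ∫ x, T.loc v x * χl v x ∂(m v)) := by
  -- the level volumes `c v = m_v(U(H)(𝒪_v)) ∈ (0, ∞)`
  have hc0 : ∀ v, m v (cmLocalIntegralLevel L N H v) ≠ 0 := fun v =>
    ((isCompact_isOpen_cmLocalIntegralLevel L N H v).2.measure_pos (m v) ⟨1, (cmLocalIntegralLevel L N H v).one_mem⟩).ne'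
  have hctop : ∀ v, m v (cmLocalIntegralLevel L N H v) ≠ ∞ := fun v =>
    (isCompact_isOpen_cmLocalIntegralLevel L N H v).1.measure_lt_top.ne
  -- the normalised local measures
  let m' : ∀ v, Measure ((cmDatum L N H).Local v) := fun v => (m v (cmLocalIntegralLevel L N H v))⁻¹ • m v
  haveI : ∀ v, (m' v).IsHaarMeasure := fun v =>
    Measure.IsHaarMeasure.smul (m v) (ENNReal.inv_ne_zero.2 (hctop v)) (ENNReal.inv_ne_top.2 (hc0 v))
  have hm' : ∀ v, m' v (cmLocalIntegralLevel L N H v) = 1 := fun v => by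
    show ((m v (cmLocalIntegralLevel L N H v))⁻¹ • m v) (cmLocalIntegralLevel L N H v) = 1
    rw [Measure.smul_apply, smul_eq_mul, ENNReal.inv_mul_cancel (hc0 v) (hctop v)]
  obtain ⟨κ, hκ, h⟩ := exists_integral_eval_mul_eq_mul_integral_arch_mul_prod (L := L) (N := N) (H := H) ν μa m' hm'
  refine ⟨κ, hκ, fun T hK χ χa χl hχ => ?_⟩
  rw [h T hK χ χa χl hχ]
  congr 2
  refine Finset.prod_congr rfl fun v _ => ?_
  show ∫ x, T.loc v x * χl v x ∂((m v (cmLocalIntegralLevel L N H v))⁻¹ • m v) = _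
  rw [integral_smul_measure, ENNReal.toReal_inv, Complex.real_smul]

/-! ## §2 The class trace of a character line against a pure tensor -/

/-- **THE CLASS TRACE OF THE CHARACTER LINE `ℂ[Θ̄]` AGAINST A PURE TENSOR IS AN EULER PRODUCT.**  For Haar measures `ν` on `U(H)(𝔸_{L⁺})`, `μ_∞` on `U(H)(L⁺ ⊗ ℝ)`
and any local Haar measures `m_v` there is ONE `κ > 0` such that: for every automorphic measure `μ`, every unitary automorphic character `Θ` of `U(H)(𝔸_{L⁺})`,
every pure tensor `T = f_∞ ⊗ ⊗_v f_v` with integral levels off its bad set `S`, every `F ∈ C_c(U(H)(𝔸_{L⁺}))` with `F = T.eval` pointwise, and every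
factorisation OF `Θ` ON `T`'S BOX `Θ(g) = Θ_∞(g_∞) · ∏_{v∈S} Θ_v(g_v)` (`g_v ∈ U(H)(𝒪_v)` for `v ∉ S`):
`Tr R(F)|_{ofChar Θ μ} = κ · (∫ f_∞ Θ_∞⁻¹ dμ_∞) · ∏_{v∈S} (m_v(U(H)(𝒪_v)))⁻¹ · ∫ f_v Θ_v⁻¹ dm_v` — ★ `classTrace_mk_ofChar` (`= ∫ F Θ⁻¹ dν`) + §1 at `χ := Θ⁻¹`
(the box factorisation of `Θ⁻¹` is that of `Θ` inverted factor by factor, `mul_inv`, `Finset.prod_inv_distrib`). [cite: Rogawski1990, §13.8 p. 219 L1–2; §14.2 p. 233]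
[cite: Gelbart1975, §2.A] [cite: BorelJacquet1979, §4.1] -/
theorem exists_classTrace_mk_ofChar_eq_mul_integral_arch_mul_prod
    [MeasurableSpace (adelicGroupData (↥(maximalRealSubfield L)) L (IsCMField.complexConj L) N H).Adelic]
    [BorelSpace (adelicGroupData (↥(maximalRealSubfield L)) L (IsCMField.complexConj L) N H).Adelic]
    [MeasurableSpace (UnitaryGroup.arch (↥(maximalRealSubfield L)) L (IsCMField.complexConj L) N H)]
    [BorelSpace (UnitaryGroup.arch (↥(maximalRealSubfield L)) L (IsCMField.complexConj L) N H)]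
    [∀ v, MeasurableSpace ((cmDatum L N H).Local v)] [∀ v, BorelSpace ((cmDatum L N H).Local v)]
    (ν : Measure (adelicGroupData (↥(maximalRealSubfield L)) L (IsCMField.complexConj L) N H).Adelic) [ν.IsHaarMeasure]
    (μa : Measure (UnitaryGroup.arch (↥(maximalRealSubfield L)) L (IsCMField.complexConj L) N H)) [μa.IsHaarMeasure]
    (m : ∀ v, Measure ((cmDatum L N H).Local v)) [∀ v, (m v).IsHaarMeasure] :
    ∃ κ : ℝ, 0 < κ ∧ ∀ (μ : Measure (adelicGroupData (↥(maximalRealSubfield L)) L (IsCMField.complexConj L) N H).automorphicQuotient)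
      [(adelicGroupData (↥(maximalRealSubfield L)) L (IsCMField.complexConj L) N H).IsAutomorphicMeasure μ]
      (Θ : (adelicGroupData (↥(maximalRealSubfield L)) L (IsCMField.complexConj L) N H).AutomorphicCharacter)
      (T : PureTensor L N H), (∀ v ∉ T.S, T.K v = cmLocalIntegralLevel L N H v) →
      ∀ (F : C_c((adelicGroupData (↥(maximalRealSubfield L)) L (IsCMField.complexConj L) N H).Adelic, ℂ)), (∀ g, F g = T.eval g) →
      ∀ (Θa : UnitaryGroup.arch (↥(maximalRealSubfield L)) L (IsCMField.complexConj L) N H → ℂ) (θ : ∀ v, (cmDatum L N H).Local v → ℂ),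
        (∀ g, (∀ v ∉ T.S, (cmDatum L N H).toLocal v g ∈ T.K v) →
          ((Θ g : ℂˣ) : ℂ) = Θa (archPart (↥(maximalRealSubfield L)) L (IsCMField.complexConj L) N H g) * ∏ v ∈ T.S, θ v ((cmDatum L N H).toLocal v g)) →
        (DiscreteClass.mk (DiscreteAutomorphicRep.ofChar Θ μ)).classTrace ν F =
          (κ : ℂ) * ((∫ a, T.arch a * (Θa a)⁻¹ ∂μa) *
            ∏ v ∈ T.S, (((m v (cmLocalIntegralLevel L N H v)).toReal⁻¹ : ℝ) : ℂ) * ∫ x, T.loc v x * (θ v x)⁻¹ ∂(m v)) := by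
  obtain ⟨κ, hκ, h⟩ := exists_integral_eval_mul_eq_mul_integral_arch_mul_prod_of_isHaarMeasure (L := L) (N := N) (H := H) ν μa m
  refine ⟨κ, hκ, fun μ _ Θ T hK F hF Θa θ hΘ => ?_⟩
  rw [classTrace_mk_ofChar ν Θ F]
  have hχ : ∀ g, (∀ v ∉ T.S, (cmDatum L N H).toLocal v g ∈ T.K v) →
      (((Θ g : ℂˣ) : ℂ))⁻¹ = (fun a => (Θa a)⁻¹) (archPart (↥(maximalRealSubfield L)) L (IsCMField.complexConj L) N H g) *
        ∏ v ∈ T.S, (fun v x => (θ v x)⁻¹) v ((cmDatum L N H).toLocal v g) := fun g hg => by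
    rw [hΘ g hg, mul_inv, Finset.prod_inv_distrib]
  rw [← h T hK (fun g => (((Θ g : ℂˣ) : ℂ))⁻¹) (fun a => (Θa a)⁻¹) (fun v x => (θ v x)⁻¹) hχ]
  exact integral_congr_ae (Filter.Eventually.of_forall fun g => congrArg (fun y : ℂ => y * (((Θ g : ℂˣ) : ℂ))⁻¹) (hF g))

/-- **THE TWIN FOR THE LINE `ℂ[Θ] = ofChar Θ⁻¹ μ`** (on which `R(g) = Θ(g)`, ★ `ofChar_toContRep_apply` at `Θ⁻¹`): with the same ONE `κ > 0`, for every factorisation of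
`Θ` on `T`'s box, `Tr R(F)|_{ofChar Θ⁻¹ μ} = κ · (∫ f_∞ Θ_∞ dμ_∞) · ∏_{v∈S} (m_v(U(H)(𝒪_v)))⁻¹ · ∫ f_v Θ_v dm_v` — ★ `classTrace_mk_ofChar` gives `∫ F · (Θ⁻¹)⁻¹ = ∫ F Θ`
(★ `AutomorphicCharacter.coe_inv_apply`, `inv_inv`), then §1 at `χ := Θ`.  This is the orientation of the θ-line of record `d₁ = mk (ofChar Θ⁻¹ μ₁)`.
[cite: Rogawski1990, §13.8 p. 219 L1–2; §14.2 p. 233] [cite: Gelbart1975, §2.A] [cite: BorelJacquet1979, §4.1] -/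
theorem exists_classTrace_mk_ofChar_inv_eq_mul_integral_arch_mul_prod
    [MeasurableSpace (adelicGroupData (↥(maximalRealSubfield L)) L (IsCMField.complexConj L) N H).Adelic]
    [BorelSpace (adelicGroupData (↥(maximalRealSubfield L)) L (IsCMField.complexConj L) N H).Adelic]
    [MeasurableSpace (UnitaryGroup.arch (↥(maximalRealSubfield L)) L (IsCMField.complexConj L) N H)]
    [BorelSpace (UnitaryGroup.arch (↥(maximalRealSubfield L)) L (IsCMField.complexConj L) N H)]
    [∀ v, MeasurableSpace ((cmDatum L N H).Local v)] [∀ v, BorelSpace ((cmDatum L N H).Local v)]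
    (ν : Measure (adelicGroupData (↥(maximalRealSubfield L)) L (IsCMField.complexConj L) N H).Adelic) [ν.IsHaarMeasure]
    (μa : Measure (UnitaryGroup.arch (↥(maximalRealSubfield L)) L (IsCMField.complexConj L) N H)) [μa.IsHaarMeasure]
    (m : ∀ v, Measure ((cmDatum L N H).Local v)) [∀ v, (m v).IsHaarMeasure] :
    ∃ κ : ℝ, 0 < κ ∧ ∀ (μ : Measure (adelicGroupData (↥(maximalRealSubfield L)) L (IsCMField.complexConj L) N H).automorphicQuotient)
      [(adelicGroupData (↥(maximalRealSubfield L)) L (IsCMField.complexConj L) N H).IsAutomorphicMeasure μ]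
      (Θ : (adelicGroupData (↥(maximalRealSubfield L)) L (IsCMField.complexConj L) N H).AutomorphicCharacter)
      (T : PureTensor L N H), (∀ v ∉ T.S, T.K v = cmLocalIntegralLevel L N H v) →
      ∀ (F : C_c((adelicGroupData (↥(maximalRealSubfield L)) L (IsCMField.complexConj L) N H).Adelic, ℂ)), (∀ g, F g = T.eval g) →
      ∀ (Θa : UnitaryGroup.arch (↥(maximalRealSubfield L)) L (IsCMField.complexConj L) N H → ℂ) (θ : ∀ v, (cmDatum L N H).Local v → ℂ),
        (∀ g, (∀ v ∉ T.S, (cmDatum L N H).toLocal v g ∈ T.K v) →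
          ((Θ g : ℂˣ) : ℂ) = Θa (archPart (↥(maximalRealSubfield L)) L (IsCMField.complexConj L) N H g) * ∏ v ∈ T.S, θ v ((cmDatum L N H).toLocal v g)) →
        (DiscreteClass.mk (DiscreteAutomorphicRep.ofChar Θ⁻¹ μ)).classTrace ν F =
          (κ : ℂ) * ((∫ a, T.arch a * Θa a ∂μa) *
            ∏ v ∈ T.S, (((m v (cmLocalIntegralLevel L N H v)).toReal⁻¹ : ℝ) : ℂ) * ∫ x, T.loc v x * θ v x ∂(m v)) := by
  obtain ⟨κ, hκ, h⟩ := exists_integral_eval_mul_eq_mul_integral_arch_mul_prod_of_isHaarMeasure (L := L) (N := N) (H := H) ν μa m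
  refine ⟨κ, hκ, fun μ _ Θ T hK F hF Θa θ hΘ => ?_⟩
  rw [classTrace_mk_ofChar ν Θ⁻¹ F, ← h T hK (fun g => ((Θ g : ℂˣ) : ℂ)) Θa θ hΘ]
  refine integral_congr_ae (Filter.Eventually.of_forall fun g => ?_)
  show F g * (((Θ⁻¹ g : ℂˣ) : ℂ))⁻¹ = T.eval g * ((Θ g : ℂˣ) : ℂ)
  rw [AdelicGroupData.AutomorphicCharacter.coe_inv_apply, inv_inv]
  exact congrArg (fun y : ℂ => y * ((Θ g : ℂˣ) : ℂ)) (hF g)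

/-! ## §3 One bad place: the constants absorbed into the adelic Haar measure -/

/-- **ONE BAD PLACE `v`, CONSTANTS ABSORBED INTO `ν`** (the consumer head for the θ-line's `hθi`: bad set `{v}`, the consumer's measurable structure and Haar
measure `mv` ONLY AT `v`, the other places Borel inside the proof).  For Haar measures `μ_∞` on `U(H)(L⁺ ⊗ ℝ)` and `mv` on `U(H)(L⁺_v)` there is a HAAR MEASURE `ν` on
`U(H)(𝔸_{L⁺})` (namely `(mv(U(H)(𝒪_v)) ∕ κ) • haar`) such that: for every automorphic measure `μ`, every unitary automorphic character `Θ`, every level family `K`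
with `K w = U(H)(𝒪_w)` for `w ≠ v`, every `gi : U(H)(L⁺ ⊗ ℝ) → ℂ`, `gv : U(H)(L⁺_v) → ℂ`, every `F ∈ C_c(U(H)(𝔸_{L⁺}))` with
`F(g) = 1_{∀ w ≠ v, g_w ∈ K w} · gi(g_∞) · gv(g_v)` (stated decidability-free as the two cases `hF₁` on the box, `hF₀` off it) and every factorisation
`Θ(g) = Θ_∞(g_∞) · θ_v(g_v)` ON THAT BOX,
`Tr R(F)|_{ofChar Θ⁻¹ μ} = (∫ gi Θ_∞ dμ_∞) · ∫ gv θ_v dmv` — EXACTLY, no constant (§2′ at the pure tensor `gi ⊗ gv ⊗ ⊗_{w≠v} 1_{K w}` with bad set `{v}` and the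
local Haar family `update (fun w => haar) v mv`; then `ν := (mv(U(H)(𝒪_v)) ∕ κ) • haar`, ★ `classTrace_mk_ofChar` being linear in `ν`).
[cite: Rogawski1990, §13.8 p. 219 L1–2; §14.2 p. 233] [cite: Gelbart1975, §2.A] [cite: BorelJacquet1979, §4.1] -/
theorem exists_isHaarMeasure_classTrace_mk_ofChar_inv_eq_integral_mul_integral
    [MeasurableSpace (adelicGroupData (↥(maximalRealSubfield L)) L (IsCMField.complexConj L) N H).Adelic]
    [BorelSpace (adelicGroupData (↥(maximalRealSubfield L)) L (IsCMField.complexConj L) N H).Adelic]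
    [MeasurableSpace (UnitaryGroup.arch (↥(maximalRealSubfield L)) L (IsCMField.complexConj L) N H)]
    [BorelSpace (UnitaryGroup.arch (↥(maximalRealSubfield L)) L (IsCMField.complexConj L) N H)]
    (v : HeightOneSpectrum (𝓞 ↥(maximalRealSubfield L)))
    [iv : MeasurableSpace ((cmDatum L N H).Local v)] [BorelSpace ((cmDatum L N H).Local v)]
    (μa : Measure (UnitaryGroup.arch (↥(maximalRealSubfield L)) L (IsCMField.complexConj L) N H)) [μa.IsHaarMeasure]
    (mv : Measure ((cmDatum L N H).Local v)) [mv.IsHaarMeasure] :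
    ∃ (ν : Measure (adelicGroupData (↥(maximalRealSubfield L)) L (IsCMField.complexConj L) N H).Adelic) (_ : ν.IsHaarMeasure),
      ∀ (μ : Measure (adelicGroupData (↥(maximalRealSubfield L)) L (IsCMField.complexConj L) N H).automorphicQuotient)
        [(adelicGroupData (↥(maximalRealSubfield L)) L (IsCMField.complexConj L) N H).IsAutomorphicMeasure μ]
        (Θ : (adelicGroupData (↥(maximalRealSubfield L)) L (IsCMField.complexConj L) N H).AutomorphicCharacter)
        (K : ∀ w, Subgroup ((cmDatum L N H).Local w)), (∀ w, w ≠ v → K w = cmLocalIntegralLevel L N H w) →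
        ∀ (gi : UnitaryGroup.arch (↥(maximalRealSubfield L)) L (IsCMField.complexConj L) N H → ℂ) (gv : (cmDatum L N H).Local v → ℂ)
          (F : C_c((adelicGroupData (↥(maximalRealSubfield L)) L (IsCMField.complexConj L) N H).Adelic, ℂ)),
          (∀ g, (∀ w, w ≠ v → (cmDatum L N H).toLocal w g ∈ K w) →
            F g = gi (archPart (↥(maximalRealSubfield L)) L (IsCMField.complexConj L) N H g) * gv ((cmDatum L N H).toLocal v g)) →
          (∀ g, (¬ ∀ w, w ≠ v → (cmDatum L N H).toLocal w g ∈ K w) → F g = 0) →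
        ∀ (Θa : UnitaryGroup.arch (↥(maximalRealSubfield L)) L (IsCMField.complexConj L) N H → ℂ) (θv : (cmDatum L N H).Local v → ℂ),
          (∀ g, (∀ w, w ≠ v → (cmDatum L N H).toLocal w g ∈ K w) →
            ((Θ g : ℂˣ) : ℂ) = Θa (archPart (↥(maximalRealSubfield L)) L (IsCMField.complexConj L) N H g) * θv ((cmDatum L N H).toLocal v g)) →
          (DiscreteClass.mk (DiscreteAutomorphicRep.ofChar Θ⁻¹ μ)).classTrace ν F =
            (∫ a, gi a * Θa a ∂μa) * ∫ x, gv x * θv x ∂mv := by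
  classical
  -- the consumer's measurable structure at `v` is the Borel one: make it literally `borel`, and use `borel` at every other place
  obtain ⟨hiv⟩ := ‹BorelSpace ((cmDatum L N H).Local v)›
  subst hiv
  letI iL : ∀ w, MeasurableSpace ((cmDatum L N H).Local w) := fun _ => borel _
  haveI : ∀ w, BorelSpace ((cmDatum L N H).Local w) := fun _ => ⟨rfl⟩
  -- Haar measures: `haar` on `U(H)(𝔸_{L⁺})` and at the places `w ≠ v`, the given `mv` at `v`
  haveI : LocallyCompactSpace (adelicGroupData (↥(maximalRealSubfield L)) L (IsCMField.complexConj L) N H).Adelic :=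
    locallyCompactSpace_cmDatum_Adelic L N H
  let ν₀ : Measure (adelicGroupData (↥(maximalRealSubfield L)) L (IsCMField.complexConj L) N H).Adelic := Measure.haar
  let m : ∀ w, Measure ((cmDatum L N H).Local w) := Function.update (fun _ => Measure.haar) v mv
  have hmv : m v = mv := by
    show Function.update (fun _ => Measure.haar) v mv v = mv
    simp only [Function.update_self]
  have hmw : ∀ w, w ≠ v → m w = Measure.haar := fun w hw => by
    show Function.update (fun _ => Measure.haar) v mv w = Measure.haar
    simp only [Function.update_of_ne hw]
  haveI : ∀ w, (m w).IsHaarMeasure := fun w => by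
    by_cases hw : w = v
    · rw [hw, hmv]; infer_instance
    · rw [hmw w hw]; infer_instance
  obtain ⟨κ, hκ, h⟩ := exists_classTrace_mk_ofChar_inv_eq_mul_integral_arch_mul_prod (L := L) (N := N) (H := H) ν₀ μa m
  -- the level volume at `v` and the normalised adelic Haar measure `ν := (mv(U(H)(𝒪_v)) ∕ κ) • haar`
  have hc0 : mv (cmLocalIntegralLevel L N H v) ≠ 0 :=
    ((isCompact_isOpen_cmLocalIntegralLevel L N H v).2.measure_pos mv ⟨1, (cmLocalIntegralLevel L N H v).one_mem⟩).ne'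
  have hctop : mv (cmLocalIntegralLevel L N H v) ≠ ∞ := (isCompact_isOpen_cmLocalIntegralLevel L N H v).1.measure_lt_top.ne
  have hrpos : 0 < (mv (cmLocalIntegralLevel L N H v)).toReal := ENNReal.toReal_pos hc0 hctop
  have hcpos : 0 < (mv (cmLocalIntegralLevel L N H v)).toReal / κ := div_pos hrpos hκ
  haveI hν : (ENNReal.ofReal ((mv (cmLocalIntegralLevel L N H v)).toReal / κ) • ν₀).IsHaarMeasure :=
    Measure.IsHaarMeasure.smul ν₀ (ENNReal.ofReal_pos.2 hcpos).ne' ENNReal.ofReal_ne_top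
  refine ⟨ENNReal.ofReal ((mv (cmLocalIntegralLevel L N H v)).toReal / κ) • ν₀, hν, fun μ _ Θ K hK gi gv F hF₁ hF₀ Θa θv hΘ => ?_⟩
  -- the pure tensor `gi ⊗ gv ⊗ ⊗_{w ≠ v} 1_{K w}` with bad set `{v}`
  let T : PureTensor L N H :=
    { S := {v}
      K := K
      loc := Function.update (fun w => ((K w : Set ((cmDatum L N H).Local w))).indicator fun _ => (1 : ℂ)) v gv
      arch := gi
      loc_eq_indicator := fun w hw => Function.update_of_ne (fun h => hw (Finset.mem_singleton.2 h)) _ _ }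
  have hTS : T.S = {v} := rfl
  have hTarch : ∀ a, T.arch a = gi a := fun _ => rfl
  have hlocv : ∀ x, T.loc v x = gv x := fun x => by
    show Function.update (fun w => ((K w : Set ((cmDatum L N H).Local w))).indicator fun _ => (1 : ℂ)) v gv v x = gv x
    rw [Function.update_self]
  have hK' : ∀ w ∉ T.S, T.K w = cmLocalIntegralLevel L N H w := fun w hw => hK w fun h => hw (Finset.mem_singleton.2 h)
  have hbox : ∀ g : (cmDatum L N H).Adelic, (∀ w ∉ T.S, (cmDatum L N H).toLocal w g ∈ T.K w) ↔
      ∀ w, w ≠ v → (cmDatum L N H).toLocal w g ∈ K w := fun g =>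
    ⟨fun h' w hw => h' w fun h'' => hw (Finset.mem_singleton.1 h''), fun h' w hw => h' w fun h'' => hw (Finset.mem_singleton.2 h'')⟩
  have hF' : ∀ g, F g = T.eval g := fun g => by
    by_cases hg : ∀ w, w ≠ v → (cmDatum L N H).toLocal w g ∈ K w
    · rw [hF₁ g hg, T.eval_eq_of_forall_mem g ((hbox g).2 hg), hTS, Finset.prod_singleton, hlocv]
    · rw [hF₀ g hg]
      obtain ⟨w, hw, hgw⟩ : ∃ w, w ≠ v ∧ (cmDatum L N H).toLocal w g ∉ K w := by
        by_contra hcon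
        exact hg fun w hw => by_contra fun hgw => hcon ⟨w, hw, hgw⟩
      exact (T.eval_eq_zero_of_not_mem g (fun h' => hw (Finset.mem_singleton.1 h')) hgw).symm
  -- the factorisation of `Θ` on `T`'s box, with the one local factor `θv` at `v`
  have hΘ' : ∀ g, (∀ w ∉ T.S, (cmDatum L N H).toLocal w g ∈ T.K w) →
      ((Θ g : ℂˣ) : ℂ) = Θa (archPart (↥(maximalRealSubfield L)) L (IsCMField.complexConj L) N H g) *
        ∏ w ∈ T.S, Function.update (fun (w : HeightOneSpectrum (𝓞 ↥(maximalRealSubfield L))) (_ : (cmDatum L N H).Local w) => (1 : ℂ))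
          v θv w ((cmDatum L N H).toLocal w g) := fun g hg => by
    rw [hΘ g ((hbox g).1 hg), hTS, Finset.prod_singleton, Function.update_self]
  have key := h μ Θ T hK' F hF' Θa _ hΘ'
  rw [hTS, Finset.prod_singleton, Function.update_self, hmv] at key
  simp only [hTarch, hlocv] at key
  -- `Tr` against `c • haar` is `c · Tr` against `haar` on the character line (★ `classTrace_mk_ofChar`)
  rw [classTrace_mk_ofChar (μ := μ) _ Θ⁻¹ F, integral_smul_measure, ENNReal.toReal_ofReal hcpos.le,
    ← classTrace_mk_ofChar (μ := μ) ν₀ Θ⁻¹ F, key, Complex.real_smul]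
  have hκ0 : (κ : ℂ) ≠ 0 := Complex.ofReal_ne_zero.2 hκ.ne'
  have hr0 : ((mv (cmLocalIntegralLevel L N H v)).toReal : ℂ) ≠ 0 := Complex.ofReal_ne_zero.2 hrpos.ne'
  push_cast
  field_simp

end Summit.HodgeConjecture.HodgeConjecture.R90.S10

end
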